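import Literature.AlgebraicGeometry.Resolution.CobordantBlowupExtReesBridge
import HarnessLib

/-!
# The extended Rees algebra along a ring homomorphism: the coefficientwise map `T[t⁻¹, 𝒥ₙ tⁿ] → T'[t⁻¹, 𝒥ₙ' tⁿ]` (`𝒥ₙ T' ⊆ 𝒥ₙ'`),
# its values on `t⁻¹` and on the base, and the extension of the vertex ideal
# (door `HypersurfaceCentreConstruction`, stmt-ResolutionOfSingularities-19897; (desc-τ) case A′, the base-change brick `hbc` — first three clauses)

Topic: `Summits/ResolutionOfSingularities/ResolutionOfSingularities/Theorems`. Helper for the door item `HypersurfaceCentreConstruction`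
(stmt-ResolutionOfSingularities-19897, route `WeightedInvariant`), line `local-engine`, def-free.  …Iota3TauDescentBaseTwoAssembly proves case (A′) of
(desc-τ) in the door setting MODULO `hbc`: a ring homomorphism `ψ : extReesAlgebra 𝒥 → extReesAlgebra 𝒥'` over `φ : T → T'`, `𝒥ₙ' = 𝒥ₙ T'`, with
(1) `ψ ∘ (T → B) = (T' → B') ∘ φ`, (2) `ψ t⁻¹ = t⁻¹`, (3) `vertex(B') ≤ vertex(B)·B'`, (4) order reflection at primes.  THIS FILE supplies `ψ` with
(1)–(3) for ANY ring homomorphism and ANY filtrations with `𝒥ₙ T' ≤ 𝒥ₙ'` ((3) under `𝒥ₙ' = 𝒥ₙ T'`): the restriction of the coefficientwise map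
`AddMonoidAlgebra.mapRingHom ℤ φ` of Laurent polynomials (the tree's `IdealFiltration.extendedReesMap` on the `extReesAlgebra` carrier).

* `extReesAlgebra.mapRingHom_mem` — the coefficientwise map carries `extReesAlgebra 𝒥` into `extReesAlgebra 𝒥'`;
* **`extReesAlgebra.exists_map`** — ∃ `ψ` with (1), (2), its value `ψ (a tⁿ) = φ(a) tⁿ` on Laurent monomials, and (3) when `𝒥ₙ' = 𝒥ₙ T'`.

Clause (4) (order reflection) is the flat base change `B ⊗_T T' ≅ B'` (Mathlib `AddMonoidAlgebra.scalarTensorEquiv` + flatness) and formal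
smoothness of the localised maps; it is NOT in this file.

[OURS · L1 W4.3 · (desc-τ) case A′, base-change brick (1)–(3)]  Replaces the role of NO printed item; NOT a statement of the manuscript under
review [claim: Hironaka2017, status: under-review]; AI work, weaker than expert review.  No definition; no axiom.

## References

* J. Włodarczyk, *Functorial resolution by torus actions*, arXiv:2203.03090, Def. 2.3.5, App. Def. 5.1.1 (functoriality of `B = Spec 𝒪[t⁻¹, 𝒥 t]`).
  [Wlodarczyk2022]
-/

noncomputable section

set_option linter.dupNamespace false -- mandated namespace `Summit.<Summit>.<Problem>` of this single-conjunct summit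

open scoped LaurentPolynomial
open LaurentPolynomial Literature.AlgebraicGeometry.Resolution

namespace Summit.ResolutionOfSingularities.ResolutionOfSingularities.Cruxes.HypersurfaceCentreConstruction.LocalEngine

namespace ExtReesMap

variable {A A' : Type} [CommRing A] [CommRing A'] (φ : A →+* A') (I : ℕ → Ideal A) (I' : ℕ → Ideal A')

/-- Coefficientwise maps fix the monomials `tⁿ`. [folklore] -/
theorem mapRingHom_T (n : ℤ) : AddMonoidAlgebra.mapRingHom ℤ φ (T n : A[T;T⁻¹]) = T n := by
  change AddMonoidAlgebra.mapRingHom ℤ φ (AddMonoidAlgebra.single n (1 : A)) = AddMonoidAlgebra.single n (1 : A')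
  rw [AddMonoidAlgebra.mapRingHom_single, map_one]

/-- Coefficientwise maps act on constants through the coefficient map. [folklore] -/
theorem mapRingHom_C (a : A) : AddMonoidAlgebra.mapRingHom ℤ φ (C a) = C (φ a) := by
  rw [← single_eq_C, AddMonoidAlgebra.mapRingHom_single, single_eq_C]

/-- **The coefficientwise map carries `A[t⁻¹, 𝒥ₙ tⁿ]` into `A'[t⁻¹, 𝒥ₙ' tⁿ]`** when `φ(𝒥ₙ) ⊆ 𝒥ₙ'` (generators go to generators).
[cite: Wlodarczyk2022, App. Def. 5.1.1] -/
theorem mapRingHom_mem (hle : ∀ n, (I n).map φ ≤ I' n) {b : A[T;T⁻¹]} (hb : b ∈ extReesAlgebra I) :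
    AddMonoidAlgebra.mapRingHom ℤ φ b ∈ extReesAlgebra I' := by
  induction hb using Algebra.adjoin_induction with
  | mem x hx =>
    rcases hx with rfl | ⟨n, hn, a, ha, rfl⟩
    · rw [mapRingHom_T]
      exact (extReesAlgebra.tInv I').2
    · rw [map_mul, mapRingHom_C, mapRingHom_T]
      exact extReesAlgebra.C_mul_T_mem I' hn (hle n (Ideal.mem_map_of_mem φ ha))
  | algebraMap a =>
    rw [← C_eq_algebraMap, mapRingHom_C, C_eq_algebraMap]
    exact Subalgebra.algebraMap_mem _ (φ a)
  | add x y _ _ hx hy => rw [map_add]; exact add_mem hx hy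
  | mul x y _ _ hx hy => rw [map_mul]; exact mul_mem hx hy

/-- **THE BASE-CHANGE HOMOMORPHISM OF EXTENDED REES ALGEBRAS** along `φ : A → A'` with `φ(𝒥ₙ) ⊆ 𝒥ₙ'`: a ring homomorphism
`ψ : A[t⁻¹, 𝒥ₙ tⁿ] → A'[t⁻¹, 𝒥ₙ' tⁿ]` which is the coefficientwise map on Laurent polynomials, so that (1) `ψ ∘ (A → B) = (A' → B') ∘ φ`,
(2) `ψ t⁻¹ = t⁻¹`, `ψ (a tⁿ) = φ(a) tⁿ`; and (3) if moreover `𝒥ₙ' = 𝒥ₙ A'` for `n ≥ 1`, the vertex ideal of `B'` lies in the extension of the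
vertex ideal of `B`. [cite: Wlodarczyk2022, Def. 2.3.5, App. Def. 5.1.1] -/
theorem exists_map (hle : ∀ n, (I n).map φ ≤ I' n) :
    ∃ ψ : extReesAlgebra I →+* extReesAlgebra I',
      (∀ b, ((ψ b : extReesAlgebra I') : A'[T;T⁻¹]) = AddMonoidAlgebra.mapRingHom ℤ φ (b : A[T;T⁻¹])) ∧
      (∀ a : A, ψ (algebraMap A (extReesAlgebra I) a) = algebraMap A' (extReesAlgebra I') (φ a)) ∧
      ψ (extReesAlgebra.tInv I) = extReesAlgebra.tInv I' ∧
      ((∀ n, 0 < n → I' n = (I n).map φ) →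
        extReesAlgebra.vertexIdeal I' ≤ (extReesAlgebra.vertexIdeal I).map ψ) := by
  classical
  let ψ : extReesAlgebra I →+* extReesAlgebra I' :=
    ((AddMonoidAlgebra.mapRingHom ℤ φ).comp (extReesAlgebra I).val.toRingHom).codRestrict (extReesAlgebra I')
      fun b => mapRingHom_mem φ I I' hle b.2
  have hψ : ∀ b, ((ψ b : extReesAlgebra I') : A'[T;T⁻¹]) = AddMonoidAlgebra.mapRingHom ℤ φ (b : A[T;T⁻¹]) := fun _ => rfl
  refine ⟨ψ, hψ, fun a => ?_, ?_, fun heq => ?_⟩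
  · apply Subtype.ext
    rw [hψ, Subalgebra.coe_algebraMap, Subalgebra.coe_algebraMap, ← C_eq_algebraMap, ← C_eq_algebraMap, mapRingHom_C]
  · apply Subtype.ext
    rw [hψ, extReesAlgebra.coe_tInv, extReesAlgebra.coe_tInv, mapRingHom_T]
  · -- the vertex ideal of `B'` is generated by the `a' tⁿ`, `a' ∈ 𝒥ₙ' = 𝒥ₙ A' = span (φ '' 𝒥ₙ)`
    rw [extReesAlgebra.vertexIdeal, Ideal.span_le]
    rintro g ⟨n, hn, a', ha', hg⟩
    rw [SetLike.mem_coe]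
    have hle' : (I n).map φ ≤ I' n := hle n
    rw [heq n hn] at ha'
    have key : ∀ (h : C a' * T (n : ℤ) ∈ extReesAlgebra I'),
        (⟨C a' * T (n : ℤ), h⟩ : extReesAlgebra I') ∈ (extReesAlgebra.vertexIdeal I).map ψ := by
      refine Submodule.span_induction (p := fun a'' _ => ∀ (h : C a'' * T (n : ℤ) ∈ extReesAlgebra I'),
        (⟨C a'' * T (n : ℤ), h⟩ : extReesAlgebra I') ∈ (extReesAlgebra.vertexIdeal I).map ψ) ?_ ?_ ?_ ?_ ha'
      · rintro _ ⟨a, ha, rfl⟩ h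
        have hgen : (⟨C a * T (n : ℤ), extReesAlgebra.C_mul_T_mem I hn ha⟩ : extReesAlgebra I) ∈ extReesAlgebra.vertexIdeal I :=
          Ideal.subset_span ⟨n, hn, a, ha, rfl⟩
        have hψeq : ψ ⟨C a * T (n : ℤ), extReesAlgebra.C_mul_T_mem I hn ha⟩ = ⟨C (φ a) * T (n : ℤ), h⟩ := by
          apply Subtype.ext
          rw [hψ]
          change AddMonoidAlgebra.mapRingHom ℤ φ (C a * T (n : ℤ)) = C (φ a) * T (n : ℤ)
          rw [map_mul, mapRingHom_C, mapRingHom_T]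
        rw [← hψeq]
        exact Ideal.mem_map_of_mem ψ hgen
      · intro h
        have h0 : (⟨C (0 : A') * T (n : ℤ), h⟩ : extReesAlgebra I') = 0 := by
          apply Subtype.ext
          change C (0 : A') * T (n : ℤ) = 0
          rw [map_zero, zero_mul]
        rw [h0]; exact zero_mem _
      · intro a₁ a₂ ha₁ ha₂ h₁ h₂ h
        have hm₁ : C a₁ * T (n : ℤ) ∈ extReesAlgebra I' := extReesAlgebra.C_mul_T_mem I' hn (hle' ha₁)
        have hm₂ : C a₂ * T (n : ℤ) ∈ extReesAlgebra I' := extReesAlgebra.C_mul_T_mem I' hn (hle' ha₂)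
        have hsum : (⟨C (a₁ + a₂) * T (n : ℤ), h⟩ : extReesAlgebra I') = ⟨_, hm₁⟩ + ⟨_, hm₂⟩ := by
          apply Subtype.ext
          change C (a₁ + a₂) * T (n : ℤ) = C a₁ * T (n : ℤ) + C a₂ * T (n : ℤ)
          rw [map_add, add_mul]
        rw [hsum]
        exact add_mem (h₁ hm₁) (h₂ hm₂)
      · intro c a₁ ha₁ h₁ h
        have hm₁ : C a₁ * T (n : ℤ) ∈ extReesAlgebra I' := extReesAlgebra.C_mul_T_mem I' hn (hle' ha₁)
        have hprod : (⟨C (c • a₁) * T (n : ℤ), h⟩ : extReesAlgebra I') = algebraMap A' (extReesAlgebra I') c * ⟨_, hm₁⟩ := by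
          apply Subtype.ext
          rw [Subalgebra.coe_mul, Subalgebra.coe_algebraMap, ← C_eq_algebraMap]
          change C (c • a₁) * T (n : ℤ) = C c * (C a₁ * T (n : ℤ))
          rw [smul_eq_mul, map_mul, mul_assoc]
        rw [hprod]
        exact Ideal.mul_mem_left _ _ (h₁ hm₁)
    have hgmem : C a' * T (n : ℤ) ∈ extReesAlgebra I' := hg ▸ g.2
    have hgeq : g = ⟨C a' * T (n : ℤ), hgmem⟩ := Subtype.ext hg
    rw [hgeq]
    exact key hgmem

end ExtReesMap

end Summit.ResolutionOfSingularities.ResolutionOfSingularities.Cruxes.HypersurfaceCentreConstruction.LocalEngine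

end
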